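import Mathlib.Probability.Distributions.Binomial
import Mathlib.Analysis.SpecialFunctions.Pow.Real
import HarnessLib

/-!
# Time-to-solution of a heuristic annealer: repetitions to a target success probability

Topic `Literature/Computability/QuantumComplexity` (pub-qadeq lane, CLAIMS §5: the annealing /
optimisation rows E-19, E-29, E-31, E-32, E-40, E-45, E-56, E-57, E-62, E-63 all state their
advantage as a TIME-TO-SOLUTION or runtime ratio; this file fixes that metric in the tree's vocabulary
so lane reports can name it). The source is the paper that DEFINED the benchmark discipline:
[cite: RonnowEtAl2014] (Rønnow, Wang, Job, Boixo, Isakov, Wecker, Martinis, Lidar, Troyer,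
*Defining and detecting quantum speedup*, Science 345, 420 (2014) = arXiv:1401.2910).

HONEST FRAMING: instance-level adjudication of specific advantage claims; no claim about BQP vs BPP
or the summit. Nothing here says anything about any device or algorithm; the file only fixes the
arithmetic `success probability per run ↦ repetitions ↦ time to solution` and the two accounting
identities the source prints (parallel replicas; fixed vs optimal annealing time).

## Source statements formalised

* “All annealing methods mentioned above are heuristic. They are not guaranteed to find the global
  optimum in a single annealing run, but only find it with a certain instance-dependent success
  probability s ≤ 1. … The total annealing time is defined as the time to perform R annealing runs,
  where R is the number of repetitions needed to find the ground state at least once with probability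
  p: R = ⌈log(1 − p)/log(1 − s)⌉” [cite: RonnowEtAl2014, §3 eq. (1) (arXiv labelled eq:repetitions)].
* “If the success probability of one annealing run is denoted by s, then the probability of failing
  to find the ground state after R independent repetitions … is (1−s)^R, and the total success
  probability of finding the ground state at least once in R repetitions is P = 1 − (1−s)^R. Thus the
  number of repetitions needed … is found by solving p = 1 − (1−s)^R”
  [cite: RonnowEtAl2014, Supplementary Methods ‘Success probabilities’].
* “The pure annealing time for R repetitions is straightforwardly defined as t_anneal = R t_a”;
  wall-clock model “t_total(N) = G t_p(N) + R t_r(N)” (G gauges, programming time t_p, run time per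
  repetition t_r) [cite: RonnowEtAl2014, Supplementary Methods ‘Wall-clock and annealing times’].
* Parallel replicas: “using C replicas the probability that at least one will find the ground state
  is s' = 1 − (1−s)^C … R' = ⌈log(1−p)/log(1−s')⌉ = ⌈log(1−p)/(C log(1−s))⌉ = R/C”
  [cite: RonnowEtAl2014, Supplementary Methods ‘Optimizing the annealing time / parallel embedding’].

## Contents (all proved; 0 named facts)

* `successProb s R = 1 − (1 − s)^R`, with `one_sub_binomial_real_zero`: it IS the probability of at
  least one success in `R` independent trials (Mathlib's binomial law, `Bin(R, s).real {0} = (1−s)^R`).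
* `repetitionsReal s p = log(1−p)/log(1−s)` and `repetitions s p = ⌈repetitionsReal s p⌉₊`.
* `successProb_ge_iff` — **the defining equivalence**: for `0 < s < 1`, `p < 1` and `R : ℕ`,
  `p ≤ successProb s R ↔ repetitionsReal s p ≤ R`; hence `le_successProb_repetitions` (the ceiling
  achieves the target) and `successProb_lt_of_lt_repetitions` (nothing smaller does) — i.e. eq. (1)
  is exactly the least number of runs reaching probability `p`.
* `ttsAnneal t_a s p = repetitions s p · t_a`, `ttsWall G t_p R t_r = G t_p + R t_r` (definitions).
* `repetitionsReal_replicas` — `C` parallel replicas divide the real repetition count by `C` exactly: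
  `repetitionsReal (1 − (1−s)^C) p = repetitionsReal s p / C`.
* (Not typed: the ‘fixed suboptimal annealing time makes the measured speedup an upper bound’
  remark of §4/§5.3.1 is, as arithmetic, `div_le_div_of_nonneg_left` in Mathlib; a report should
  cite the source's sentence, not a lemma.)

## References

* [RonnowEtAl2014] T. F. Rønnow et al., *Defining and detecting quantum speedup*, Science 345,
  420–424 (2014), doi:10.1126/science.1252319 = arXiv:1401.2910: §3 eq. (1); §4; §5.1–5.3;
  Supplementary Methods (‘Success probabilities and gauge averaging’, ‘Wall-clock and annealing
  times’, ‘Optimal annealing times’, parallel-replica argument). Read via `lit read arxiv:1401.2910`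
  (held LaTeX source, chunks p0004, p0006, p0011, p0012).
-/

noncomputable section

open Real

namespace Literature.Computability.QuantumComplexity

/-! ### Success probability of repeated independent runs -/

/-- `P = 1 − (1 − s)^R`: the probability of finding the ground state at least once in `R`
independent runs of success probability `s` each.
[cite: RonnowEtAl2014, Supplementary Methods ‘Success probabilities’ (`P = 1 − (1−s)^R`)] -/
def successProb (s : ℝ) (R : ℕ) : ℝ := 1 - (1 - s) ^ R

/-- `successProb` is the complement of the binomial probability of ZERO successes:
`1 − Bin(R, s){0} = 1 − (1−s)^R` (Mathlib's binomial law on `ℕ`).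
[cite: RonnowEtAl2014, Supplementary Methods ‘Success probabilities’ (“the probability of failing
… after R independent repetitions … is (1−s)^R”)] -/
theorem one_sub_binomial_real_zero (s : unitInterval) (R : ℕ) :
    1 - (ProbabilityTheory.binomial R s).real {0} = successProb (s : ℝ) R := by
  rw [ProbabilityTheory.binomial_real_zero, successProb]

/-- `0 ≤ P ≤ 1` for `0 ≤ s ≤ 1`. [cite: RonnowEtAl2014, Supplementary Methods ‘Success probabilities’] -/
theorem successProb_mem_Icc {s : ℝ} (hs0 : 0 ≤ s) (hs1 : s ≤ 1) (R : ℕ) :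
    0 ≤ successProb s R ∧ successProb s R ≤ 1 := by
  unfold successProb
  have h0 : 0 ≤ (1 - s) ^ R := pow_nonneg (by linarith) R
  have h1 : (1 - s) ^ R ≤ 1 := pow_le_one₀ (by linarith) (by linarith)
  constructor <;> linarith

/-- More runs never hurt: `P` is monotone in `R` (for `0 ≤ s ≤ 1`).
[cite: RonnowEtAl2014, Supplementary Methods ‘Success probabilities’] -/
theorem successProb_mono {s : ℝ} (hs0 : 0 ≤ s) (hs1 : s ≤ 1) {R R' : ℕ} (h : R ≤ R') :
    successProb s R ≤ successProb s R' := by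
  unfold successProb
  have := pow_le_pow_of_le_one (by linarith : 0 ≤ 1 - s) (by linarith) h
  linarith

/-! ### Repetitions to a target probability: eq. (1) -/

/-- The real-valued repetition count `log(1 − p) / log(1 − s)` (the argument of the ceiling in
eq. (1)). [cite: RonnowEtAl2014, §3 eq. (1)] -/
def repetitionsReal (s p : ℝ) : ℝ := Real.log (1 - p) / Real.log (1 - s)

/-- `R = ⌈log(1 − p) / log(1 − s)⌉`: the number of repetitions needed to find the ground state at
least once with probability `p`, given per-run success probability `s`.
[cite: RonnowEtAl2014, §3 eq. (1)] -/
def repetitions (s p : ℝ) : ℕ := ⌈repetitionsReal s p⌉₊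

/-- **The defining equivalence** (“found by solving p = 1 − (1−s)^R”): for `0 < s < 1`, `p < 1`,
`R` runs reach total success probability `p` iff `R ≥ log(1−p)/log(1−s)`.
[cite: RonnowEtAl2014, Supplementary Methods ‘Success probabilities’ with §3 eq. (1)] -/
theorem successProb_ge_iff {s p : ℝ} (hs0 : 0 < s) (hs1 : s < 1) (hp1 : p < 1) (R : ℕ) :
    p ≤ successProb s R ↔ repetitionsReal s p ≤ R := by
  have h1s : 0 < 1 - s := by linarith
  have h1p : 0 < 1 - p := by linarith
  have hlog : Real.log (1 - s) < 0 := Real.log_neg h1s (by linarith)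
  unfold successProb repetitionsReal
  rw [div_le_iff_of_neg hlog]
  constructor
  · intro h
    have hpow : (1 - s) ^ R ≤ 1 - p := by linarith
    have := (Real.log_le_log_iff (pow_pos h1s R) h1p).2 hpow
    rwa [Real.log_pow] at this
  · intro h
    have h' : Real.log ((1 - s) ^ R) ≤ Real.log (1 - p) := by rwa [Real.log_pow]
    have := (Real.log_le_log_iff (pow_pos h1s R) h1p).1 h'
    linarith

/-- The ceiling of eq. (1) achieves the target: `p ≤ 1 − (1−s)^{repetitions s p}`.
[cite: RonnowEtAl2014, §3 eq. (1)] -/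
theorem le_successProb_repetitions {s p : ℝ} (hs0 : 0 < s) (hs1 : s < 1) (hp1 : p < 1) :
    p ≤ successProb s (repetitions s p) :=
  (successProb_ge_iff hs0 hs1 hp1 _).2 (Nat.le_ceil _)

/-- … and no smaller number of runs does: `R < repetitions s p → 1 − (1−s)^R < p`, so eq. (1) is
EXACTLY the least `R` with total success probability `≥ p`. [cite: RonnowEtAl2014, §3 eq. (1)] -/
theorem successProb_lt_of_lt_repetitions {s p : ℝ} (hs0 : 0 < s) (hs1 : s < 1)
    (hp1 : p < 1) {R : ℕ} (hR : R < repetitions s p) : successProb s R < p := by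
  refine lt_of_not_ge fun h => ?_
  have h1 := (successProb_ge_iff hs0 hs1 hp1 R).1 h
  have h2 : (R : ℝ) < repetitionsReal s p := Nat.lt_ceil.1 hR
  linarith

/-! ### Time to solution -/

/-- Pure annealing time-to-solution `t_anneal = R · t_a` with `R` from eq. (1).
[cite: RonnowEtAl2014, Supplementary Methods ‘Wall-clock and annealing times’ (`t_anneal = R t_a`)] -/
def ttsAnneal (t_a s p : ℝ) : ℝ := (repetitions s p : ℝ) * t_a

/-- Wall-clock model `t_total = G · t_p + R · t_r` (`G` gauges/programmings of cost `t_p`, `R`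
repetitions of cost `t_r`). [cite: RonnowEtAl2014, Supplementary Methods ‘Wall-clock and annealing
times’ (`t_total(N) = G t_p(N) + R t_r(N)`)] -/
def ttsWall (G : ℕ) (t_p : ℝ) (R : ℕ) (t_r : ℝ) : ℝ := (G : ℝ) * t_p + (R : ℝ) * t_r

/-- `t_anneal ≥ 0` for `t_a ≥ 0`. [cite: RonnowEtAl2014, Supplementary Methods ‘Wall-clock and annealing times’] -/
theorem ttsAnneal_nonneg {t_a : ℝ} (ht : 0 ≤ t_a) (s p : ℝ) : 0 ≤ ttsAnneal t_a s p :=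
  mul_nonneg (Nat.cast_nonneg _) ht

/-- Wall-clock time dominates pure annealing time when one repetition costs at least `t_a`:
`R t_a ≤ G t_p + R t_r` for `t_p ≥ 0`, `t_a ≤ t_r` — an immediate corollary of the two printed
definitions, stated here and NOT printed as an inequality in the source, whose sentence is
“Wall-clock time … includes the setup, cooling, annealing and readout times”
[cite: RonnowEtAl2014, §5.1 with Supplementary Methods ‘Wall-clock and annealing times’]. -/
theorem ttsAnneal_le_ttsWall {t_a t_p t_r : ℝ} (s p : ℝ) (G : ℕ) (htp : 0 ≤ t_p) (h : t_a ≤ t_r) :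
    ttsAnneal t_a s p ≤ ttsWall G t_p (repetitions s p) t_r := by
  unfold ttsAnneal ttsWall
  have h1 : (repetitions s p : ℝ) * t_a ≤ (repetitions s p : ℝ) * t_r :=
    mul_le_mul_of_nonneg_left h (Nat.cast_nonneg _)
  have h2 : 0 ≤ (G : ℝ) * t_p := mul_nonneg (Nat.cast_nonneg _) htp
  linarith

/-! ### Parallel replicas -/

/-- **Parallel replicas divide the repetition count.** With `C` independent replicas per run the
per-run success probability becomes `s' = 1 − (1−s)^C` and the real repetition count is divided by
`C` exactly: `log(1−p)/log(1−s') = log(1−p)/(C·log(1−s))`.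
[cite: RonnowEtAl2014, Supplementary Methods (parallel embedding: `R' = ⌈log(1−p)/(C log(1−s))⌉ = R/C`)] -/
theorem repetitionsReal_replicas (s p : ℝ) (C : ℕ) :
    repetitionsReal (1 - (1 - s) ^ C) p = repetitionsReal s p / C := by
  unfold repetitionsReal
  rw [sub_sub_cancel, Real.log_pow, div_div, mul_comm]

/-- With replicas the success probability per run can only grow: `s ≤ 1 − (1−s)^C` for `C ≥ 1`,
`0 ≤ s ≤ 1`. [cite: RonnowEtAl2014, Supplementary Methods (parallel embedding, `s' = 1 − (1−s)^C`)] -/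
theorem le_successProb_replicas {s : ℝ} (hs0 : 0 ≤ s) (hs1 : s ≤ 1) {C : ℕ} (hC : 1 ≤ C) :
    s ≤ successProb s C := by
  have h := successProb_mono hs0 hs1 hC
  rwa [successProb, pow_one, sub_sub_cancel] at h

end Literature.Computability.QuantumComplexity

end
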